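import Summits.HubbardSuperconductivity.HubbardSuperconductivity.Theorems.AnisotropyChordHeatKernelRateGround

/-!
# Route `AnisotropyChord`: the GROUND PROJECTION by the heat flow — `e^{tE} e^{−tH} v` converges to
# the component of `v` in the `E`-eigenspace when `v` carries no spectral weight below `E`
# (finite-dimensional spectral theory, proved; the vector-level companion of lemma R)

For a Hermitian matrix `H` with eigenvector unitary `U`, eigenvalues `λ` and a vector `v` with
eigen-coordinates `y = U⋆ v`:

* `eigenCoord_gibbs` — `U⋆(e^{−tH} v) = (e^{−tλ_k} y_k)_k`;
* `eigenCoord_eq_zero_of_lt` — if `v` lies in an `H`-invariant subspace `K` on which `H ≥ E`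
  (Rayleigh quotient), then `y_k = 0` whenever `λ_k < E` (no spectral weight below `E`; the argument
  of `heatKernelRate_of_groundOverlap`, isolated);
* `groundProjection_tendsto` — with no weight below `E`,
  `e^{tE} • e^{−tH} v ⟶ w := U (𝟙_{λ = E} ⊙ y)` as `t → ∞`;
* `groundProjection_eigen` — `H w = E w`; `groundProjection_ne_zero` — `w ≠ 0` as soon as `E` is
  attained on the support of `y`; `groundProjection_mem` — `w` lies in every subspace (closed, by
  finite dimension) containing the flow `e^{−tH} v` for `t ≥ 0`;
* `groundProjection_of_groundOverlap` — the packaged form used downstream: `K` invariant, `H ≥ E` on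
  `K`, `w₀ ∈ K` an `E`-eigenvector with `⟨w₀, v⟩ ≠ 0`, `v ∈ K`, the flow stays in `K` ⇒ the rescaled
  flow converges to a NON-ZERO `E`-eigenvector in `K`.

This is the «sectorwise power method» step of the theory seat's T-INT argument (memo ROTOR-THEORY-6
§65: `e^{−t(H−E_W)} 𝟙_W → ⟨ψ_W, 𝟙_W⟩ ψ_W`).  O. Bratteli, D. Robinson, *Operator Algebras and Quantum
Statistical Mechanics* II §5.3.1.  No definition is introduced.
-/

set_option linter.dupNamespace false

noncomputable section

namespace Summit.HubbardSuperconductivity.HubbardSuperconductivity.Theorems.AnisotropyChord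

open Matrix Complex Finset Filter Topology
open scoped ComplexOrder
open Literature.MathematicalPhysics.QuantumLattice
open Literature.LinearAlgebra.Matrix (exists_polynomial_eval_eq cfc_eq_aeval_of_eval_eq)

variable {ι : Type*} [Fintype ι] [DecidableEq ι]

/-- **Heat flow in eigen-coordinates**: `U⋆(e^{−tH} v) = (e^{−tλ_k} (U⋆v)_k)_k`.
Bratteli–Robinson II §5.3.1. [folklore] -/
theorem eigenCoord_gibbs {H : Matrix ι ι ℂ} (hH : H.IsHermitian) (v : ι → ℂ) (t : ℝ) :
    star (hH.eigenvectorUnitary : Matrix ι ι ℂ) *ᵥ (NormedSpace.exp (-(t : ℂ) • H) *ᵥ v) =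
      fun k => ((Real.exp (-t * hH.eigenvalues k) : ℝ) : ℂ) *
        (star (hH.eigenvectorUnitary : Matrix ι ι ℂ) *ᵥ v) k := by
  set U : Matrix ι ι ℂ := (hH.eigenvectorUnitary : Matrix ι ι ℂ) with hU
  have hUU' : star U * U = 1 := Unitary.coe_star_mul_self _
  have h := gibbsWeight_eq_conj_diagonal hH t
  simp only [Matrix.gibbsWeight] at h
  rw [h, ← hU]
  have hstar : (star hH.eigenvectorUnitary : Matrix ι ι ℂ) = star U := rfl
  rw [hstar, mulVec_mulVec, ← Matrix.mul_assoc, ← Matrix.mul_assoc, hUU', Matrix.one_mul,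
    ← mulVec_mulVec]
  funext k
  rw [mulVec_diagonal]

/-- **No spectral weight below the sector bottom.**  If `K` is an `H`-invariant subspace on which the
Rayleigh quotient is `≥ E` and `v ∈ K`, then the eigen-coordinates of `v` vanish at every eigenvalue
`< E` (the spectral projection of `v` below `E` is a polynomial in `H` applied to `v`, hence in `K`, and
would have Rayleigh quotient `< E`).  Bratteli–Robinson II §5.3.1. [folklore] -/
theorem eigenCoord_eq_zero_of_lt {H : Matrix ι ι ℂ} (hH : H.IsHermitian)
    (K : Submodule ℂ (ι → ℂ)) (hK : ∀ x ∈ K, H *ᵥ x ∈ K)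
    (E : ℝ) (hE : ∀ x ∈ K, E * (star x ⬝ᵥ x).re ≤ (star x ⬝ᵥ H *ᵥ x).re)
    {v : ι → ℂ} (hvK : v ∈ K) (k : ι) (hlt : hH.eigenvalues k < E) :
    (star (hH.eigenvectorUnitary : Matrix ι ι ℂ) *ᵥ v) k = 0 := by
  by_contra hk
  set U : Matrix ι ι ℂ := (hH.eigenvectorUnitary : Matrix ι ι ℂ) with hU
  set y : ι → ℂ := star U *ᵥ v with hy
  -- the spectral projection below `E`, as a polynomial in `H`
  set g : ℝ → ℝ := fun s => if s < E then 1 else 0 with hg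
  obtain ⟨p, hp⟩ := exists_polynomial_eval_eq (spectrum ℝ H) (Matrix.finite_real_spectrum) g
  have hcfc : cfc g H = Polynomial.aeval H p := cfc_eq_aeval_of_eval_eq hH g p hp
  have hdiag : cfc g H = U * diagonal (fun j => ((g (hH.eigenvalues j) : ℝ) : ℂ)) * star U := by
    rw [hH.cfc_eq, IsHermitian.cfc, Unitary.conjStarAlgAut_apply]
    rfl
  set x : ι → ℂ := cfc g H *ᵥ v with hx
  have hxK : x ∈ K := by rw [hx, hcfc]; exact aeval_mulVec_mem K hK p hvK
  have hUU' : star U * U = 1 := Unitary.coe_star_mul_self _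
  have hyx : star U *ᵥ x = fun j => ((g (hH.eigenvalues j) : ℝ) : ℂ) * y j := by
    rw [hx, hdiag, mulVec_mulVec, ← Matrix.mul_assoc, ← Matrix.mul_assoc, hUU', Matrix.one_mul,
      ← mulVec_mulVec, ← hy]
    funext j
    rw [mulVec_diagonal]
  have hspec : H = U * diagonal (fun j => ((hH.eigenvalues j : ℝ) : ℂ)) * star U := by
    conv_lhs => rw [hH.spectral_theorem, Unitary.conjStarAlgAut_apply]
    rfl
  have hform : (star x ⬝ᵥ H *ᵥ x).re =
      ∑ j, hH.eigenvalues j * ((g (hH.eigenvalues j)) ^ 2 * ‖y j‖ ^ 2) := by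
    have e : star x ⬝ᵥ H *ᵥ x =
        star x ⬝ᵥ ((U * diagonal (fun j => ((hH.eigenvalues j : ℝ) : ℂ)) * star U) *ᵥ x) := by
      rw [← hspec]
    rw [e, form_conj_diagonal hH, Complex.re_sum]
    refine Finset.sum_congr rfl fun j _ => ?_
    rw [hyx]
    simp only [norm_mul, Complex.norm_real, Real.norm_eq_abs, mul_pow, sq_abs]
    rw [← Complex.ofReal_mul, Complex.ofReal_re]
  have hnorm : (star x ⬝ᵥ x).re = ∑ j, (g (hH.eigenvalues j)) ^ 2 * ‖y j‖ ^ 2 := by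
    have h1 : star x ⬝ᵥ x = star x ⬝ᵥ ((U * diagonal (fun _ => (1 : ℂ)) * star U) *ᵥ x) := by
      rw [diagonal_one, Matrix.mul_one, show U * star U = 1 from Unitary.coe_mul_star_self _,
        one_mulVec]
    rw [h1, form_conj_diagonal hH, Complex.re_sum]
    refine Finset.sum_congr rfl fun j _ => ?_
    rw [hyx, one_mul, Complex.ofReal_re, norm_mul, Complex.norm_real, Real.norm_eq_abs, mul_pow,
      sq_abs]
  have key := hE x hxK
  rw [hform, hnorm, Finset.mul_sum] at key
  have hterm : ∀ j, hH.eigenvalues j * ((g (hH.eigenvalues j)) ^ 2 * ‖y j‖ ^ 2) ≤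
      E * ((g (hH.eigenvalues j)) ^ 2 * ‖y j‖ ^ 2) := by
    intro j
    by_cases hj : hH.eigenvalues j < E
    · exact mul_le_mul_of_nonneg_right hj.le (by positivity)
    · simp [hg, hj]
  have hk' : hH.eigenvalues k * ((g (hH.eigenvalues k)) ^ 2 * ‖y k‖ ^ 2) <
      E * ((g (hH.eigenvalues k)) ^ 2 * ‖y k‖ ^ 2) := by
    have hgk : g (hH.eigenvalues k) = 1 := by simp [hg, hlt]
    rw [hgk, one_pow, one_mul]
    have hyk : 0 < ‖y k‖ ^ 2 := by
      have : y k ≠ 0 := hk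
      positivity
    exact mul_lt_mul_of_pos_right hlt hyk
  have hlt' : ∑ j, hH.eigenvalues j * ((g (hH.eigenvalues j)) ^ 2 * ‖y j‖ ^ 2) <
      ∑ j, E * ((g (hH.eigenvalues j)) ^ 2 * ‖y j‖ ^ 2) :=
    Finset.sum_lt_sum (fun j _ => hterm j) ⟨k, Finset.mem_univ _, hk'⟩
  linarith

/-- **Ground projection by the heat flow (vector limit).**  If `v` carries no spectral weight below
`E`, then `e^{tE} • e^{−tH} v ⟶ U (𝟙_{λ = E} ⊙ U⋆v)`, the component of `v` in the `E`-eigenspace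
(coordinatewise: `e^{−t(λ_k − E)} y_k → [λ_k = E] y_k`).  Bratteli–Robinson II §5.3.1. [folklore] -/
theorem groundProjection_tendsto {H : Matrix ι ι ℂ} (hH : H.IsHermitian) (v : ι → ℂ) {E : ℝ}
    (hmin : ∀ k, (star (hH.eigenvectorUnitary : Matrix ι ι ℂ) *ᵥ v) k ≠ 0 → E ≤ hH.eigenvalues k) :
    Tendsto (fun t : ℝ => ((Real.exp (t * E) : ℝ) : ℂ) • (NormedSpace.exp (-(t : ℂ) • H) *ᵥ v)) atTop
      (𝓝 ((hH.eigenvectorUnitary : Matrix ι ι ℂ) *ᵥ fun k =>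
        if hH.eigenvalues k = E then (star (hH.eigenvectorUnitary : Matrix ι ι ℂ) *ᵥ v) k else 0)) := by
  set U : Matrix ι ι ℂ := (hH.eigenvectorUnitary : Matrix ι ι ℂ) with hU
  set y : ι → ℂ := star U *ᵥ v with hy
  have hUU : U * star U = 1 := Unitary.coe_mul_star_self _
  -- the rescaled flow is `U` applied to explicit eigen-coordinates
  have hflow : ∀ t : ℝ, ((Real.exp (t * E) : ℝ) : ℂ) • (NormedSpace.exp (-(t : ℂ) • H) *ᵥ v) =
      U *ᵥ (fun k => ((Real.exp (-(t * (hH.eigenvalues k - E))) : ℝ) : ℂ) * y k) := by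
    intro t
    have e1 : NormedSpace.exp (-(t : ℂ) • H) *ᵥ v =
        U *ᵥ (star U *ᵥ (NormedSpace.exp (-(t : ℂ) • H) *ᵥ v)) := by
      rw [mulVec_mulVec, hUU, one_mulVec]
    rw [e1, eigenCoord_gibbs hH v t, ← hU, ← hy, ← mulVec_smul]
    congr 1
    funext k
    simp only [Pi.smul_apply, smul_eq_mul]
    have hexp : t * E + -t * hH.eigenvalues k = -(t * (hH.eigenvalues k - E)) := by ring
    rw [← mul_assoc, ← Complex.ofReal_mul, ← Real.exp_add, hexp]
  set ŵ : ι → ℂ := fun k => if hH.eigenvalues k = E then y k else 0 with hŵ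
  simp_rw [hflow]
  have hcont : Continuous fun x : ι → ℂ => U *ᵥ x := continuous_const.matrix_mulVec continuous_id
  refine (hcont.tendsto ŵ).comp ?_
  rw [tendsto_pi_nhds]
  intro k
  by_cases hk : hH.eigenvalues k = E
  · -- `λ_k = E`: the coordinate is constant
    have hw : ŵ k = y k := by simp [hŵ, hk]
    have hfun : (fun t : ℝ => ((Real.exp (-(t * (hH.eigenvalues k - E))) : ℝ) : ℂ) * y k) =
        fun _ => y k := by
      funext t
      rw [hk, sub_self, mul_zero, neg_zero, Real.exp_zero, Complex.ofReal_one, one_mul]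
    rw [hw, hfun]
    exact tendsto_const_nhds
  · have hw : ŵ k = 0 := by simp [hŵ, hk]
    rw [hw]
    by_cases hyk : y k = 0
    · have hfun : (fun t : ℝ => ((Real.exp (-(t * (hH.eigenvalues k - E))) : ℝ) : ℂ) * y k) =
          fun _ => 0 := by
        funext t
        rw [hyk, mul_zero]
      rw [hfun]
      exact tendsto_const_nhds
    · -- `λ_k > E`: exponential decay
      have hlt : E < hH.eigenvalues k := lt_of_le_of_ne (hmin k hyk) (Ne.symm hk)
      have hpos : 0 < hH.eigenvalues k - E := sub_pos.mpr hlt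
      have h1 : Tendsto (fun t : ℝ => -(t * (hH.eigenvalues k - E))) atTop atBot :=
        tendsto_neg_atTop_atBot.comp (tendsto_id.atTop_mul_const hpos)
      have h2 : Tendsto (fun t : ℝ => Real.exp (-(t * (hH.eigenvalues k - E)))) atTop (𝓝 0) :=
        Real.tendsto_exp_atBot.comp h1
      have h3 : Tendsto (fun t : ℝ => ((Real.exp (-(t * (hH.eigenvalues k - E))) : ℝ) : ℂ)) atTop
          (𝓝 ((0 : ℝ) : ℂ)) :=
        (Complex.continuous_ofReal.tendsto 0).comp h2
      have h4 := h3.mul_const (y k)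
      rw [Complex.ofReal_zero, zero_mul] at h4
      exact h4

/-- The ground projection is an `E`-eigenvector: `H (U (𝟙_{λ=E} ⊙ y)) = E • U (𝟙_{λ=E} ⊙ y)`. [folklore] -/
theorem groundProjection_eigen {H : Matrix ι ι ℂ} (hH : H.IsHermitian) (y : ι → ℂ) (E : ℝ) :
    H *ᵥ ((hH.eigenvectorUnitary : Matrix ι ι ℂ) *ᵥ fun k => if hH.eigenvalues k = E then y k else 0) =
      (E : ℂ) • ((hH.eigenvectorUnitary : Matrix ι ι ℂ) *ᵥ
        fun k => if hH.eigenvalues k = E then y k else 0) := by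
  set U : Matrix ι ι ℂ := (hH.eigenvectorUnitary : Matrix ι ι ℂ) with hU
  set ŵ : ι → ℂ := fun k => if hH.eigenvalues k = E then y k else 0 with hŵ
  have hUU' : star U * U = 1 := Unitary.coe_star_mul_self _
  have hspec : H = U * diagonal (fun j => ((hH.eigenvalues j : ℝ) : ℂ)) * star U := by
    conv_lhs => rw [hH.spectral_theorem, Unitary.conjStarAlgAut_apply]
    rfl
  have hdiag : diagonal (fun j => ((hH.eigenvalues j : ℝ) : ℂ)) *ᵥ ŵ = (E : ℂ) • ŵ := by
    funext k
    rw [mulVec_diagonal, Pi.smul_apply, smul_eq_mul, hŵ]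
    simp only
    split_ifs with h
    · rw [h]
    · rw [mul_zero, mul_zero]
  have e : H *ᵥ (U *ᵥ ŵ) =
      (U * diagonal (fun j => ((hH.eigenvalues j : ℝ) : ℂ)) * star U) *ᵥ (U *ᵥ ŵ) := by
    rw [← hspec]
  rw [e, mulVec_mulVec, Matrix.mul_assoc _ (star U) U, hUU', Matrix.mul_one, ← mulVec_mulVec, hdiag,
    mulVec_smul]

/-- The ground projection is non-zero as soon as `E` is attained on the support of the
eigen-coordinates. [folklore] -/
theorem groundProjection_ne_zero {H : Matrix ι ι ℂ} (hH : H.IsHermitian) (y : ι → ℂ) (E : ℝ)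
    (hatt : ∃ k, y k ≠ 0 ∧ hH.eigenvalues k = E) :
    ((hH.eigenvectorUnitary : Matrix ι ι ℂ) *ᵥ fun k => if hH.eigenvalues k = E then y k else 0) ≠ 0 := by
  set U : Matrix ι ι ℂ := (hH.eigenvectorUnitary : Matrix ι ι ℂ) with hU
  set ŵ : ι → ℂ := fun k => if hH.eigenvalues k = E then y k else 0 with hŵ
  have hUU' : star U * U = 1 := Unitary.coe_star_mul_self _
  obtain ⟨k, hyk, hk⟩ := hatt
  intro h0
  have h1 : ŵ = 0 := by
    have e : ŵ = star U *ᵥ (U *ᵥ ŵ) := by rw [mulVec_mulVec, hUU', one_mulVec]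
    rw [e, h0, mulVec_zero]
  have h2 : ŵ k = y k := by simp [hŵ, hk]
  exact hyk (by rw [← h2, h1]; rfl)

/-- The limit of the rescaled flow lies in every subspace containing the flow for `t ≥ 0`
(subspaces of a finite-dimensional space are closed). [folklore] -/
theorem groundProjection_mem {H : Matrix ι ι ℂ} (hH : H.IsHermitian) (v : ι → ℂ) {E : ℝ}
    (hmin : ∀ k, (star (hH.eigenvectorUnitary : Matrix ι ι ℂ) *ᵥ v) k ≠ 0 → E ≤ hH.eigenvalues k)
    (K : Submodule ℂ (ι → ℂ)) (hflowK : ∀ t : ℝ, 0 ≤ t → NormedSpace.exp (-(t : ℂ) • H) *ᵥ v ∈ K) :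
    ((hH.eigenvectorUnitary : Matrix ι ι ℂ) *ᵥ fun k =>
        if hH.eigenvalues k = E then (star (hH.eigenvectorUnitary : Matrix ι ι ℂ) *ᵥ v) k else 0) ∈ K := by
  have hcl : IsClosed (K : Set (ι → ℂ)) := K.closed_of_finiteDimensional
  refine hcl.mem_of_tendsto (groundProjection_tendsto hH v hmin) ?_
  filter_upwards [eventually_ge_atTop (0 : ℝ)] with t ht
  exact K.smul_mem _ (hflowK t ht)

/-- **Packaged form (sectorwise power method).**  `K` an `H`-invariant subspace on which `H ≥ E`,
`w₀ ∈ K` an `E`-eigenvector with `⟨w₀, v⟩ ≠ 0`, `v ∈ K`, and the heat flow of `v` stays in `K`: then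
the rescaled flow `e^{tE} e^{−tH} v` converges to a NON-ZERO vector `w ∈ K` with `H w = E w`.
(Theory seat memo ROTOR-THEORY-6 §65, «sectorwise power method»; Bratteli–Robinson II §5.3.1.) [folklore] -/
theorem groundProjection_of_groundOverlap (H : Matrix ι ι ℂ) (hH : H.IsHermitian)
    (K : Submodule ℂ (ι → ℂ)) (hK : ∀ x ∈ K, H *ᵥ x ∈ K)
    (E : ℝ) (hE : ∀ x ∈ K, E * (star x ⬝ᵥ x).re ≤ (star x ⬝ᵥ H *ᵥ x).re)
    (w₀ : ι → ℂ) (hHw₀ : H *ᵥ w₀ = (E : ℂ) • w₀)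
    (v : ι → ℂ) (hvK : v ∈ K) (hwv : star w₀ ⬝ᵥ v ≠ 0)
    (hflowK : ∀ t : ℝ, 0 ≤ t → NormedSpace.exp (-(t : ℂ) • H) *ᵥ v ∈ K) :
    ∃ w : ι → ℂ, w ∈ K ∧ w ≠ 0 ∧ H *ᵥ w = (E : ℂ) • w ∧
      Tendsto (fun t : ℝ => ((Real.exp (t * E) : ℝ) : ℂ) • (NormedSpace.exp (-(t : ℂ) • H) *ᵥ v))
        atTop (𝓝 w) := by
  set U : Matrix ι ι ℂ := (hH.eigenvectorUnitary : Matrix ι ι ℂ) with hU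
  set y : ι → ℂ := star U *ᵥ v with hy
  set z : ι → ℂ := star U *ᵥ w₀ with hz
  have hmin : ∀ k, (star (hH.eigenvectorUnitary : Matrix ι ι ℂ) *ᵥ v) k ≠ 0 → E ≤ hH.eigenvalues k := by
    intro k hk
    by_contra hlt
    push Not at hlt
    exact hk (eigenCoord_eq_zero_of_lt hH K hK E hE hvK k hlt)
  -- `E` is attained on the support of `y`
  have hatt : ∃ k, y k ≠ 0 ∧ hH.eigenvalues k = E := by
    have hsum : star w₀ ⬝ᵥ v = ∑ k, star (z k) * y k := star_dotProduct_eq_sum_eigenCoord hH w₀ v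
    obtain ⟨k, -, hk⟩ : ∃ k ∈ (Finset.univ : Finset ι), star (z k) * y k ≠ 0 := by
      by_contra h
      push Not at h
      exact hwv (by rw [hsum]; exact Finset.sum_eq_zero h)
    have hzk : z k ≠ 0 := fun h0 => hk (by rw [h0, star_zero, zero_mul])
    have hyk : y k ≠ 0 := fun h0 => hk (by rw [h0, mul_zero])
    refine ⟨k, hyk, ?_⟩
    have h := eigenCoord_of_eigenvector hH hHw₀ k
    rcases mul_eq_zero.1 h with h1 | h1
    · exact_mod_cast (sub_eq_zero.1 h1)
    · exact absurd h1 hzk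
  refine ⟨U *ᵥ fun k => if hH.eigenvalues k = E then y k else 0,
    groundProjection_mem hH v hmin K hflowK, groundProjection_ne_zero hH y E hatt,
    groundProjection_eigen hH y E, groundProjection_tendsto hH v hmin⟩

end Summit.HubbardSuperconductivity.HubbardSuperconductivity.Theorems.AnisotropyChord
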